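import Summits.ResolutionOfSingularities.ResolutionOfSingularities.Theorems.HomologicalConductorNoZenoStrictTransformM
import Summits.ResolutionOfSingularities.ResolutionOfSingularities.Theorems.HomologicalConductorNoZenoExcDegreeOnePoint
import Summits.ResolutionOfSingularities.ResolutionOfSingularities.Theorems.HomologicalConductorNoZenoH0LeResidueDegree
import HarnessLib

/-!
# Crux `NoZenoR` (stmt-ResolutionOfSingularities-19943), slot 5 (B1) `stub_L1wCoreF3`, seam2 «minimal model
# dominated by the germ resolution»: the CASE-A DICHOTOMY for a curve upstairs whose image downstairs satisfies
# Lipman's criterion (M)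

OURS (cell res-hironaka, crux chain W4.4, lead res-L0-w44-lead-1 gen 9); nothing here is a statement of the manuscript
under review (Hironaka 2017); AI-written, weaker than expert review.  SUPPORT-level, counted 0.  Def-free.  FACTS as
explicit binders (BRICK RULE): `Lipman1969_15_a` (F-98 a)) and `Lipman1969_13_1_d_rat` (F-97 d)); nothing else.

SETTING (= res-D-pv-045's `…NoZenoStrictTransformM`).  `S` a two-dimensional normal Noetherian local domain with a
RATIONAL singularity, `π : X → Spec S` a resolution, `g : X′ → X` proper birational dominant with `ψ := g ≫ π` a resolution,
`η ∈ excCurvePoints π`, `η′ ∈ excCurvePoints ψ` with `g η′ = η` (`E′ := E_{η′}` maps onto `E := E_η`), and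
`F := g^*[E] − [E′]` (effective, avoids `η′`: pv-045 `isEffective_pullback_add_neg`, `avoids_pullback_add_neg`).

RESULTS.
* §1 `residueDegree_le_excCurveDegree_of_not_avoids` — the ONE-POINT BOUND of `…NoZenoExcDegreeOnePoint` for an
  ARBITRARY effective Cartier divisor `D` avoiding `η` but not the point `x ∈ E_η`: `[κ(x) : κ(𝔪)] ≤ (D · E_η)`
  (same proof, `D` abstracted).
* §2 `excCurveDegree_self_eq_add_transform` — `(E·E)_X = (E′·E′)_{X′} + (F·E′)` (F-98 a) + additivity).
* §3 **`caseA_of_not_three_mul_h0_lt`** — if `E` satisfies (M) `3·h⁰(E) < h⁰(𝒪_{2E})` but `E′` does NOT, then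
  (A) `F` avoids EVERY point of `E′ = closure {η′}` («`g^*[E] = [E′]` near `E′`») and (B) `h⁰(E) < h⁰(E′)`.
  Proof (numerics only): with `e, s, e′, s′` the four lengths, F-97 d) gives `(E·E) = 2e − s < −e` and
  `(E′·E′) = 2e′ − s′ ≥ −e′`; if `F` met a point `t` of `E′` then `(F·E′) ≥ [κ(t) : κ(𝔪)] ≥ e′` (§1 + o5's
  `h0_primeDivisorIdeal_toNat_le_residueDegree_base`), whence `(E·E) ≥ 3e′ − s′ ≥ 0`, absurd; so `(F·E′) = 0`… more
  precisely `F` avoids every point, and then `−e′ ≤ (E′·E′) ≤ (E·E) < −e`.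
* §4 corollaries: `three_mul_h0_lt_h0_sq_transform_of_not_avoids` ((M) IS inherited as soon as `F` meets `E′`, e.g. when
  a curve contracted by `g` meets `E′`), and the FIRST-KIND form `caseA_of_firstKind` (a first-kind `E′` — `h⁰(𝒪_{2E′}) =
  3h⁰(E′)`, e.g. a node curve — mapping ONTO a curve `E` satisfying (M) forces Case A and `h⁰(E) < h⁰(E′)`).
Consumed by seam2 of the slot-5 closer in the form: every exceptional curve of the MINIMAL resolution `Y_min` of the
upstairs germ `S′` (all satisfy (M), Lipman (27.3)) lifts along `h : W → Y_min` to an OLD curve — a new (first-kind) curve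
mapping onto it is in Case A, which the companion file excludes for REGULAR `E′` (`h⁰(E) = h⁰(E′)` there).

References: J. Lipman, *Rational singularities …*, Publ. Math. IHÉS 36 (1969), §13 Prop. (13.1) d) (p. 223), §15 a)
(p. 227), §27 Cor. (27.3) (p. 277) [`Lipman1969`]; W. Fulton, *Intersection Theory* (1998), Def. 1.4 [`Fulton1998`].
-/

noncomputable section

-- single-problem summit: the doubled namespace component `ResolutionOfSingularities` is forced
set_option linter.dupNamespace false

namespace Summit.ResolutionOfSingularities.ResolutionOfSingularities.Theorems.NoZeno.ExcCount

open CategoryTheory AlgebraicGeometry TopologicalSpace IsLocalRing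
open Literature.AlgebraicGeometry.Resolution Literature.AlgebraicGeometry.Motives
open Literature.AlgebraicGeometry.Motives.RatFn

/-! ## §1 The one-point bound for an arbitrary effective Cartier divisor -/

section OnePoint

variable {T : Type} [CommRing T] [IsLocalRing T] {X : Scheme.{0}} [IsIntegral X]
  [IsLocallyNoetherian X] (π : X ⟶ Spec (.of T)) [IsProper π]

/-- **ONE-POINT BOUND, arbitrary effective divisor, literal currency.**  `π : X ⟶ Spec T` proper (`T` local,
`X` integral locally Noetherian), `η ∈ excCurvePoints π`, `D` an effective Cartier divisor avoiding `η` but NOT the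
specialisation `x` of `η`: the residue degree `[κ(x) : κ(𝔪)]` of the point of `E_η` over `x` is at most `(D · E_η)`.
(The body of pv-045's `residueDegree_ofPointPt_le_excCurveDegree` with `D` abstracted.)
[cite: Lipman1969, Section 13 (p. 223); Fulton1998, Definition 1.4] -/
theorem residueDegree_ofPointPt_le_excCurveDegree_of_not_avoids {η x : X} (hη : η ∈ excCurvePoints π)
    {D : CartierDivisor X} (hDeff : D.IsEffective) (hDη : D.Avoids η) (hDx : ¬ D.Avoids x) (hx : η ⤳ x) :
    ((((ClosedSubvariety.ofPoint X η).ι ≫ π).residueDegree (ClosedSubvariety.ofPointPt η hx) : ℕ) : ℤ) ≤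
      excCurveDegree π D η := by
  -- the structure morphism of `E_η` over the residue field
  obtain ⟨q, hq⟩ := exists_fac_specResidueField π hη.1
  haveI : IsIntegral (Over.mk q : SchemeOver (ResidueField T)).left :=
    inferInstanceAs (IsIntegral (ClosedSubvariety.ofPoint X η).carrier)
  haveI : IsProper (Over.mk q : SchemeOver (ResidueField T)).hom := isProper_of_fac_specResidueField π hq
  have hav : D.Avoids ((ClosedSubvariety.ofPoint X η).ι (genericPoint (ClosedSubvariety.ofPoint X η).carrier)) := by
    have hgen := ClosedSubvariety.genericPoint_ofPoint (X := X) η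
    unfold ClosedSubvariety.genericPoint at hgen
    rw [hgen]
    exact hDη
  -- `y`, the point of `E_η` over `x`, is a closed point of the one-dimensional `E_η`
  have hxη : x ≠ η := by
    rintro rfl
    exact hDx hDη
  have hE1 : Order.height (⊤ : ↥(ClosedSubvariety.ofPoint X η).carrier) = 1 := height_top_ofPoint_eq_one π hη
  have hy0 : Order.height (ClosedSubvariety.ofPointPt η hx) = 0 := height_ofPointPt_eq_zero π hη hx hxη
  have hcoh : Order.coheight (ClosedSubvariety.ofPointPt η hx) = 1 :=
    CartierDivisor.coheight_eq_one_of_height_eq_zero (C := (Over.mk q : SchemeOver (ResidueField T)))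
      hE1 hy0
  -- pass to the degree over `κ(𝔪)` of the honest pull-back `D' = D|_{E_η}`
  have key : excCurveDegree π D η =
      CartierDivisor.degree (Over.mk q : SchemeOver (ResidueField T))
        (D.pullbackAvoiding (ClosedSubvariety.ofPoint X η).ι hav) := by
    rw [excCurveDegree_eq_degree_of_fac π hq]
    congr 1
    exact CartierDivisor.pullbackRep_of_avoids _ _ hav
  rw [residueDegree_ι_comp_eq_of_fac π hq, key, CartierDivisor.degree_eq_finsum]
  set D' : CartierDivisor (Over.mk q : SchemeOver (ResidueField T)).left :=
    D.pullbackAvoiding (ClosedSubvariety.ofPoint X η).ι hav with hD'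
  have hD'eff : D'.IsEffective := hDeff.pullbackAvoiding (ClosedSubvariety.ofPoint X η).ι hav
  -- a chart of `D'` at `y`; its local equation is not a unit at `y`
  obtain ⟨i, hi⟩ := D'.covers (ClosedSubvariety.ofPointPt η hx)
  have hi' : (ClosedSubvariety.ofPoint X η).ι (ClosedSubvariety.ofPointPt η hx) ∈ D.U i.1 := hi
  have hu : ¬ IsUnitAt ((ClosedSubvariety.ofPoint X η).ι (ClosedSubvariety.ofPointPt η hx)) (D.f i.1) :=
    fun h => hDx (CartierDivisor.Avoids.of_mem hi' h)
  have hu' : ¬ IsUnitAt (ClosedSubvariety.ofPointPt η hx) (D'.f i) :=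
    hDeff.not_isUnitAt_pullbackAvoiding (ClosedSubvariety.ofPoint X η).ι hav i hi hu
  have hord : 0 < D'.ordAt (ClosedSubvariety.ofPointPt η hx) := hD'eff.ordAt_pos hi hu' hcoh
  -- the finite sum of non-negative terms dominates its `y`-term, which dominates `[κ(y) : κ(𝔪)]`
  have hfin : (Function.support fun z : ↥(Over.mk q : SchemeOver (ResidueField T)).left => D'.ordAt z *
      ((toSpecOver (Over.mk q : SchemeOver (ResidueField T))).left.residueDegree z : ℤ)).Finite :=
    (CartierDivisor.finite_support_cycle D').subset (Function.support_mul_subset_left _ _)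
  rw [finsum_eq_sum _ hfin]
  have hrpos : (0 : ℤ) <
      ((toSpecOver (Over.mk q : SchemeOver (ResidueField T))).left.residueDegree
        (ClosedSubvariety.ofPointPt η hx) : ℤ) := by
    exact_mod_cast Nat.pos_of_ne_zero (CartierDivisor.residueDegree_toSpecOver_ne_zero hy0)
  have hterm : ((toSpecOver (Over.mk q : SchemeOver (ResidueField T))).left.residueDegree
        (ClosedSubvariety.ofPointPt η hx) : ℤ) ≤
      D'.ordAt (ClosedSubvariety.ofPointPt η hx) *
        ((toSpecOver (Over.mk q : SchemeOver (ResidueField T))).left.residueDegree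
          (ClosedSubvariety.ofPointPt η hx) : ℤ) :=
    le_mul_of_one_le_left hrpos.le hord
  have hymem : (ClosedSubvariety.ofPointPt η hx : ↥(Over.mk q : SchemeOver (ResidueField T)).left) ∈
      hfin.toFinset :=
    hfin.mem_toFinset.mpr (Function.mem_support.mpr (lt_of_lt_of_le hrpos hterm).ne')
  calc ((q.residueDegree (ClosedSubvariety.ofPointPt η hx) : ℕ) : ℤ)
      = ((toSpecOver (Over.mk q : SchemeOver (ResidueField T))).left.residueDegree
          (ClosedSubvariety.ofPointPt η hx) : ℤ) := rfl
    _ ≤ D'.ordAt (ClosedSubvariety.ofPointPt η hx) *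
        ((toSpecOver (Over.mk q : SchemeOver (ResidueField T))).left.residueDegree
          (ClosedSubvariety.ofPointPt η hx) : ℤ) := hterm
    _ ≤ ∑ z ∈ hfin.toFinset, D'.ordAt z *
        ((toSpecOver (Over.mk q : SchemeOver (ResidueField T))).left.residueDegree z : ℤ) :=
      Finset.single_le_sum (fun z _ => mul_nonneg (hD'eff.ordAt_nonneg z) (Nat.cast_nonneg _)) hymem

/-- **ONE-POINT BOUND, arbitrary effective divisor, `Scheme.Hom.residueDegree` currency**:
`[κ(x) : κ(𝔪)] = π.residueDegree x ≤ (D · E_η)` for `D` effective, avoiding `η`, not avoiding `x`, `η ⤳ x`.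
[cite: Lipman1969, Section 13 (p. 223); Fulton1998, Definition 1.4] -/
theorem residueDegree_le_excCurveDegree_of_not_avoids {η x : X} (hη : η ∈ excCurvePoints π)
    {D : CartierDivisor X} (hDeff : D.IsEffective) (hDη : D.Avoids η) (hDx : ¬ D.Avoids x) (hx : η ⤳ x) :
    ((π.residueDegree x : ℕ) : ℤ) ≤ excCurveDegree π D η := by
  rw [← residueDegree_ι_comp_ofPointPt π hx]
  exact residueDegree_ofPointPt_le_excCurveDegree_of_not_avoids π hη hDeff hDη hDx hx

/-- **`h⁰(E_η) ≤ (D · E_η)` as soon as the effective divisor `D` (avoiding `η`) meets `E_η`** (at a point `x`):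
`h⁰(E_η) ≤ [κ(x) : κ(𝔪)]` (o5's `h0_primeDivisorIdeal_toNat_le_residueDegree_base`) `≤ (D · E_η)` (§1).
[cite: Lipman1969, Section 10 (p. 212) and Section 13 (p. 223)] -/
theorem h0_toNat_le_excCurveDegree_of_not_avoids [IsNoetherianRing T] {η x : X} (hη : η ∈ excCurvePoints π)
    {D : CartierDivisor X} (hDeff : D.IsEffective) (hDη : D.Avoids η) (hDx : ¬ D.Avoids x) (hx : η ⤳ x) :
    (((h0 π (primeDivisorIdeal η)).toNat : ℕ) : ℤ) ≤ excCurveDegree π D η := by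
  have hxη : x ≠ η := by
    rintro rfl
    exact hDx hDη
  have h1 := h0_primeDivisorIdeal_toNat_le_residueDegree_base π hη hx hxη
  have h2 := residueDegree_le_excCurveDegree_of_not_avoids π hη hDeff hDη hDx hx
  exact le_trans (by exact_mod_cast h1) h2

end OnePoint

/-! ## §2 `(E·E)_X = (E′·E′)_{X′} + (F·E′)` -/

section Decomposition

variable {S : Type} [CommRing S] [IsNoetherianRing S] [IsLocalRing S] [IsDomain S] [IsIntegrallyClosed S]
  {X X' : Scheme.{0}} [IsIntegral X] [IsIntegral X'] [IsLocallyNoetherian X] [IsLocallyNoetherian X']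
  {π : X ⟶ Spec (.of S)}

/-- **`(E·E)_X = (E′·E′)_{X′} + (F·E′)`** for `F = g^*[E] − [E′]`: F-98 a) `(g^*[E] · E′) = ([E] · E)` and additivity.
[cite: Lipman1969, Section 15, statement a) (p. 227)] -/
theorem excCurveDegree_self_eq_add_transform (h15a : Lipman1969_15_a.{0}) (hdim : ringKrullDim S = 2)
    (hπ : IsResolution π) (g : X' ⟶ X) [IsProper g] [IsDominant g] (hbir : IsBirational g)
    (hψ : IsResolution (g ≫ π)) {η : X} (hη : η ∈ excCurvePoints π) {η' : X'}
    (hη' : η' ∈ excCurvePoints (g ≫ π)) (hg : g.base η' = η)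
    (hF : IsEffectiveCartier (primeDivisorIdeal η)) (hF' : IsEffectiveCartier (primeDivisorIdeal η')) :
    excCurveDegree π (CartierDivisor.ofIsEffectiveCartier (primeDivisorIdeal η) hF) η =
      excCurveDegree (g ≫ π) (CartierDivisor.ofIsEffectiveCartier (primeDivisorIdeal η') hF') η' +
        excCurveDegree (g ≫ π)
          ((CartierDivisor.ofIsEffectiveCartier (primeDivisorIdeal η) hF).pullback g +
            -CartierDivisor.ofIsEffectiveCartier (primeDivisorIdeal η') hF') η' := by
  subst hg
  haveI : IsProper (g ≫ π) := hψ.isProper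
  have h15 := h15a S hdim X π hπ X' g ‹IsProper g› hbir hψ.isRegular
    (CartierDivisor.ofIsEffectiveCartier (primeDivisorIdeal (g.base η')) hF) (g.base η') hη η' rfl hη'.2
  rw [excCurveDegree_add (g ≫ π) hη', excCurveDegree_neg (g ≫ π) hη', h15]
  ring

end Decomposition

/-! ## §3 The Case-A dichotomy -/

section CaseA

variable {S : Type} [CommRing S] [IsNoetherianRing S] [IsLocalRing S] [IsDomain S] [IsIntegrallyClosed S]
  {X X' : Scheme.{0}} [IsIntegral X] [IsIntegral X'] [IsLocallyNoetherian X] [IsLocallyNoetherian X']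
  {π : X ⟶ Spec (.of S)}

omit [IsDomain S] [IsIntegrallyClosed S] [IsIntegral X] [IsLocallyNoetherian X] in
/-- The `h⁰`-numbers of an integral exceptional curve are finite: `h0 π 𝓘_η ≠ ⊤`. [cite: Lipman1969, Section 10 (p. 212)] -/
theorem h0_primeDivisorIdeal_ne_top' (π : X ⟶ Spec (.of S)) [IsProper π] {η : X} (hη : η ∈ excCurvePoints π) :
    h0 π (primeDivisorIdeal η) ≠ ⊤ := by
  have h := h0_pow_primeDivisorIdeal_ne_top π hη one_ne_zero
  rwa [pow_one] at h

/-- **F-97 d) for one curve, `toNat` form**: `(E·E) = 2e − s` with `e = h⁰(E)`, `s = h⁰(𝒪_{2E})`.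
[cite: Lipman1969, Proposition (13.1) d) (p. 223)] -/
theorem excCurveDegree_self_eq_h0 (h131d : Lipman1969_13_1_d_rat.{0}) (hdim : ringKrullDim S = 2)
    (hS : HasRationalSingularity S) (hπ : IsResolution π) {η : X} (hη : η ∈ excCurvePoints π)
    (hF : IsEffectiveCartier (primeDivisorIdeal η)) :
    excCurveDegree π (CartierDivisor.ofIsEffectiveCartier (primeDivisorIdeal η) hF) η =
      2 * (((h0 π (primeDivisorIdeal η)).toNat : ℕ) : ℤ) - (((h0 π (primeDivisorIdeal η ^ 2)).toNat : ℕ) : ℤ) := by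
  rw [h131d S hdim hS X π hπ η hη η hη hF, ← pow_two]
  ring

/-- **THE CASE-A DICHOTOMY.**  `S` rational, `π : X → Spec S` a resolution, `g : X′ → X` proper birational dominant with
`g ≫ π` a resolution, `η′ ∈ excCurvePoints (g ≫ π)` over `η ∈ excCurvePoints π`.  If `E = E_η` satisfies (M)
(`3·h⁰(E) < h⁰(𝒪_{2E})`) and `E′ = E_{η′}` does NOT, then (A) the divisor `F = g^*[E] − [E′]` avoids EVERY point of
`closure {η′}` and (B) `h⁰(E) < h⁰(E′)`.  Conditional on F-97 d), F-98 a) (explicit binders).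
[cite: Lipman1969, Proposition (13.1) d) (p. 223), Section 15 a) (p. 227), Corollary (27.3) (p. 277)] -/
theorem caseA_of_not_three_mul_h0_lt (h131d : Lipman1969_13_1_d_rat.{0}) (h15a : Lipman1969_15_a.{0})
    (hdim : ringKrullDim S = 2) (hS : HasRationalSingularity S)
    (hπ : IsResolution π) (g : X' ⟶ X) [IsProper g] [IsDominant g] (hbir : IsBirational g)
    (hψ : IsResolution (g ≫ π)) {η : X} (hη : η ∈ excCurvePoints π) {η' : X'}
    (hη' : η' ∈ excCurvePoints (g ≫ π)) (hg : g.base η' = η)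
    (hF : IsEffectiveCartier (primeDivisorIdeal η)) (hF' : IsEffectiveCartier (primeDivisorIdeal η'))
    (hM : 3 * h0 π (primeDivisorIdeal η) < h0 π (primeDivisorIdeal η ^ 2))
    (hM' : ¬ 3 * h0 (g ≫ π) (primeDivisorIdeal η') < h0 (g ≫ π) (primeDivisorIdeal η' ^ 2)) :
    (∀ t : X', η' ⤳ t →
      ((CartierDivisor.ofIsEffectiveCartier (primeDivisorIdeal η) hF).pullback g +
        -CartierDivisor.ofIsEffectiveCartier (primeDivisorIdeal η') hF').Avoids t) ∧
    h0 π (primeDivisorIdeal η) < h0 (g ≫ π) (primeDivisorIdeal η') := by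
  subst hg
  haveI : IsProper π := hπ.isProper
  haveI : IsProper (g ≫ π) := hψ.isProper
  -- `𝒪_{X, g η′}` is a discrete valuation ring
  have hcoh : Order.coheight (g.base η') = 1 := IsResolution.coheight_eq_one_of_mem_excCurvePoints hdim hπ hη
  haveI : IsPrincipalIdealRing (X.presheaf.stalk (g.base η')) :=
    isPrincipalIdealRing_stalk_of_coheight_eq_one hπ.isRegular hcoh
  haveI : ValuationRing (X.presheaf.stalk (g.base η')) := inferInstance
  set F := (CartierDivisor.ofIsEffectiveCartier (primeDivisorIdeal (g.base η')) hF).pullback g +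
    -CartierDivisor.ofIsEffectiveCartier (primeDivisorIdeal η') hF' with hFdef
  have hFeff : F.IsEffective := isEffective_pullback_add_neg g hF hF'
  have hFav : F.Avoids η' := avoids_pullback_add_neg g hF hF' hbir
  -- the four lengths, all finite
  have f1 : h0 π (primeDivisorIdeal (g.base η')) ≠ ⊤ := h0_primeDivisorIdeal_ne_top' π hη
  have f2 : h0 π (primeDivisorIdeal (g.base η') ^ 2) ≠ ⊤ := h0_pow_primeDivisorIdeal_ne_top π hη two_ne_zero
  have f1' : h0 (g ≫ π) (primeDivisorIdeal η') ≠ ⊤ := h0_primeDivisorIdeal_ne_top' (g ≫ π) hη'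
  have f2' : h0 (g ≫ π) (primeDivisorIdeal η' ^ 2) ≠ ⊤ := h0_pow_primeDivisorIdeal_ne_top (g ≫ π) hη' two_ne_zero
  set e := (h0 π (primeDivisorIdeal (g.base η'))).toNat with he
  set s := (h0 π (primeDivisorIdeal (g.base η') ^ 2)).toNat with hs
  set e' := (h0 (g ≫ π) (primeDivisorIdeal η')).toNat with he'
  set s' := (h0 (g ≫ π) (primeDivisorIdeal η' ^ 2)).toNat with hs'
  have hMnat : 3 * e < s := by
    rw [← ENat.coe_toNat f1, ← ENat.coe_toNat f2] at hM
    exact_mod_cast hM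
  have hM'nat : s' ≤ 3 * e' := by
    rw [← ENat.coe_toNat f1', ← ENat.coe_toNat f2'] at hM'
    have : ¬ ((3 * e' : ℕ) : ℕ∞) < ((s' : ℕ) : ℕ∞) := by exact_mod_cast hM'
    have : ¬ 3 * e' < s' := fun h => this (by exact_mod_cast h)
    omega
  -- the intersection numbers
  have hEE := excCurveDegree_self_eq_h0 h131d hdim hS hπ hη hF
  have hE'E' := excCurveDegree_self_eq_h0 h131d hdim hS hψ hη' hF'
  have hdec := excCurveDegree_self_eq_add_transform h15a hdim hπ g hbir hψ hη hη' rfl hF hF'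
  have hFnn : 0 ≤ excCurveDegree (g ≫ π) F η' := excCurveDegree_nonneg_of_isEffective (g ≫ π) hη' hFeff hFav
  rw [← hFdef] at hdec
  -- (A): `F` avoids every point of `E′`
  have hA : ∀ t : X', η' ⤳ t → F.Avoids t := by
    intro t ht
    by_contra hFt
    have hbd := h0_toNat_le_excCurveDegree_of_not_avoids (g ≫ π) hη' hFeff hFav hFt ht
    -- `(E·E) = (E′·E′) + (F·E′) ≥ (2e′ − s′) + e′ ≥ 0`, but `(E·E) = 2e − s < −e ≤ 0`
    have h1 : (0 : ℤ) ≤ excCurveDegree π (CartierDivisor.ofIsEffectiveCartier (primeDivisorIdeal (g.base η')) hF)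
        (g.base η') := by
      rw [hdec, hE'E']
      have : (((h0 (g ≫ π) (primeDivisorIdeal η')).toNat : ℕ) : ℤ) = e' := rfl
      omega
    rw [hEE] at h1
    omega
  refine ⟨hA, ?_⟩
  -- (B): `e < e′` from `−e′ ≤ (E′·E′) ≤ (E·E) < −e`
  have hB : e < e' := by
    have h1 : excCurveDegree π (CartierDivisor.ofIsEffectiveCartier (primeDivisorIdeal (g.base η')) hF)
        (g.base η') = 2 * (e : ℤ) - s := hEE
    have h2 : excCurveDegree (g ≫ π) (CartierDivisor.ofIsEffectiveCartier (primeDivisorIdeal η') hF') η' =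
        2 * (e' : ℤ) - s' := hE'E'
    have h3 := hdec
    rw [h1, h2] at h3
    omega
  rw [← ENat.coe_toNat f1, ← ENat.coe_toNat f1']
  exact_mod_cast hB

/-! ## §4 Corollaries -/

/-- **(M) IS INHERITED as soon as `F = g^*[E] − [E′]` meets `E′`** (e.g. when a curve contracted by `g` meets `E′`):
contrapositive of (A). [cite: Lipman1969, Corollary (27.3) (p. 277), Section 15 a) (p. 227)] -/
theorem three_mul_h0_lt_h0_sq_transform_of_not_avoids (h131d : Lipman1969_13_1_d_rat.{0}) (h15a : Lipman1969_15_a.{0})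
    (hdim : ringKrullDim S = 2) (hS : HasRationalSingularity S)
    (hπ : IsResolution π) (g : X' ⟶ X) [IsProper g] [IsDominant g] (hbir : IsBirational g)
    (hψ : IsResolution (g ≫ π)) {η : X} (hη : η ∈ excCurvePoints π) {η' : X'}
    (hη' : η' ∈ excCurvePoints (g ≫ π)) (hg : g.base η' = η)
    (hF : IsEffectiveCartier (primeDivisorIdeal η)) (hF' : IsEffectiveCartier (primeDivisorIdeal η'))
    (hM : 3 * h0 π (primeDivisorIdeal η) < h0 π (primeDivisorIdeal η ^ 2))
    {t : X'} (ht : η' ⤳ t)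
    (hFt : ¬ ((CartierDivisor.ofIsEffectiveCartier (primeDivisorIdeal η) hF).pullback g +
        -CartierDivisor.ofIsEffectiveCartier (primeDivisorIdeal η') hF').Avoids t) :
    3 * h0 (g ≫ π) (primeDivisorIdeal η') < h0 (g ≫ π) (primeDivisorIdeal η' ^ 2) := by
  by_contra hM'
  exact hFt ((caseA_of_not_three_mul_h0_lt h131d h15a hdim hS hπ g hbir hψ hη hη' hg hF hF' hM hM').1 t ht)

/-- **FIRST-KIND FORM.**  A first-kind curve `E′` upstairs (`h⁰(𝒪_{2E′}) = 3·h⁰(E′)`, e.g. the exceptional curve of a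
point blow-up) mapping ONTO a curve `E` satisfying (M) downstairs is in Case A: `F = g^*[E] − [E′]` avoids every point of
`E′`, and `h⁰(E) < h⁰(E′)`.  (With `h⁰(E) = h⁰(E′)` — the companion file, for `E′` regular — this is absurd: first-kind
curves are CONTRACTED by any morphism to a resolution all of whose curves satisfy (M), e.g. the minimal one.)
[cite: Lipman1969, Corollary (27.3) (p. 277), Theorem (27.1) (p. 275)] -/
theorem caseA_of_firstKind (h131d : Lipman1969_13_1_d_rat.{0}) (h15a : Lipman1969_15_a.{0})
    (hdim : ringKrullDim S = 2) (hS : HasRationalSingularity S)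
    (hπ : IsResolution π) (g : X' ⟶ X) [IsProper g] [IsDominant g] (hbir : IsBirational g)
    (hψ : IsResolution (g ≫ π)) {η : X} (hη : η ∈ excCurvePoints π) {η' : X'}
    (hη' : η' ∈ excCurvePoints (g ≫ π)) (hg : g.base η' = η)
    (hF : IsEffectiveCartier (primeDivisorIdeal η)) (hF' : IsEffectiveCartier (primeDivisorIdeal η'))
    (hM : 3 * h0 π (primeDivisorIdeal η) < h0 π (primeDivisorIdeal η ^ 2))
    (hfk : h0 (g ≫ π) (primeDivisorIdeal η' ^ 2) = 3 * h0 (g ≫ π) (primeDivisorIdeal η')) :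
    (∀ t : X', η' ⤳ t →
      ((CartierDivisor.ofIsEffectiveCartier (primeDivisorIdeal η) hF).pullback g +
        -CartierDivisor.ofIsEffectiveCartier (primeDivisorIdeal η') hF').Avoids t) ∧
    h0 π (primeDivisorIdeal η) < h0 (g ≫ π) (primeDivisorIdeal η') :=
  caseA_of_not_three_mul_h0_lt h131d h15a hdim hS hπ g hbir hψ hη hη' hg hF hF' hM (by rw [hfk]; exact lt_irrefl _)

end CaseA

end Summit.ResolutionOfSingularities.ResolutionOfSingularities.Theorems.NoZeno.ExcCount

end
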